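import Summits.RiemannHypothesis.RiemannHypothesis.Theorems.WeilGroundStateGroundStatesConvergeToXiStubArchPolarTruncation
import Summits.RiemannHypothesis.RiemannHypothesis.Theorems.WeilGroundStateGroundStatesConvergeToXiStubZeroSideTruncation
import Summits.RiemannHypothesis.RiemannHypothesis.Theorems.WeilGroundStateGroundStatesConvergeToXiMellinByParts
import Literature.NumberTheory.LFunctions.WeilExplicit
import HarnessLib

/-!
# `WeilGroundState.GroundStatesConvergeToXi` — dominated convergence for the Mellin, polar and archimedean sides of the explicit formula
(crux item stmt-RiemannHypothesis-1527, route route-RiemannHypothesis-WeilGroundState; line `Sketch`,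
stub `stub_weilArchPolar_dominated` (H1); `--supports`)

Sequences in the EXPONENTIAL WEIL CLASS with a COMMON envelope: `F k : ℝ → ℂ` smooth with
`‖F k‖, ‖(F k)'‖, ‖(F k)''‖ ≤ C e^{-b₀|t|}`, `b₀ > 1/2`, converging pointwise to a continuous `G`.

* Mellin side: `(F k)^(s) → Ĝ(s)` for `0 ≤ Re s ≤ 1`, by dominated convergence in
  `∫ F_k(t) e^{(s-1/2)t} dt` with the `k`-uniform majorant `C e^{-b₀|t|} e^{|t|/2}`
  (`apTrunc_norm_mul_cexp_le`, `zsTrunc_integrable_exp_weight`).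
* Polar side: the Mellin side at `s = 0` and `s = 1`.
* Archimedean side (digamma form, `weilArchTerm g = (1/2π) weilArchIntegral g − g(0) log π`):
  `F k 0 → G 0` is the pointwise hypothesis, and `weilArchIntegral (F k) → weilArchIntegral G` by
  dominated convergence in `t` against the weight `Re ψ(1/4 + it/2)`: the pointwise convergence
  is the Mellin side on the critical line, `‖(F k)^(1/2 + it)‖ ≤ K/(1 + t²)` UNIFORMLY in `k`
  (`zsTrunc_norm_weilMellin_le`, both weighted norms `∫‖F k‖e^{|t|/2}`, `∫‖(F k)''‖e^{|t|/2}`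
  being at most `C ∫ e^{-b₀|t|} e^{|t|/2}`), `|Re ψ(1/4 + it/2)| ≤ C_ψ + log(1 + |t|)`
  (`apTrunc_digammaWeight_bound`) and `(C_ψ + log(1 + |t|))/(1 + t²)` is integrable
  (`apTrunc_integrable_log_div`).  The limit `G` need not lie in the class: integrability of the
  limit integrands is part of the conclusion of dominated convergence.

No new definitions; no named fact is used.
-/

noncomputable section

set_option linter.dupNamespace false

open scoped Topology Real ComplexConjugate
open Filter Set MeasureTheory Complex

namespace Summit.RiemannHypothesis.RiemannHypothesis.Theorems.GroundStatesConvergeToXi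

open Literature.NumberTheory.LFunctions

/-! ## The Mellin side -/

/-- **Dominated convergence of the transform in the closed strip.** If the `F k` are continuous
with `‖F k t‖ ≤ C e^{-b₀|t|}` uniformly in `k` (`b₀ > 1/2`) and `F k → G` pointwise, then
`(F k)^(s) → Ĝ(s)` for `0 ≤ Re s ≤ 1` (majorant `C e^{-b₀|t|} e^{|t|/2}`). [folklore] -/
theorem apDom_tendsto_weilMellin {F : ℕ → ℝ → ℂ} {G : ℝ → ℂ} (hc : ∀ k, Continuous (F k))
    {C b₀ : ℝ} (hb : 1 / 2 < b₀) (h0 : ∀ k t, ‖F k t‖ ≤ C * Real.exp (-(b₀ * |t|)))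
    (hlim : ∀ t, Tendsto (fun k => F k t) atTop (𝓝 (G t))) {s : ℂ} (hs0 : 0 ≤ s.re)
    (hs1 : s.re ≤ 1) :
    Tendsto (fun k => weilMellin (F k) s) atTop (𝓝 (weilMellin G s)) := by
  unfold weilMellin
  refine tendsto_integral_of_dominated_convergence
    (fun t : ℝ => C * (Real.exp (-(b₀ * |t|)) * Real.exp (|t| / 2)))
    (fun k => ?_) ((zsTrunc_integrable_exp_weight hb).const_mul C)
    (fun k => ae_of_all _ fun t => ?_) (ae_of_all _ fun t => ?_)
  · exact ((hc k).mul (by fun_prop)).aestronglyMeasurable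
  · calc ‖F k t * cexp ((s - 1 / 2) * t)‖ ≤ ‖F k t‖ * Real.exp (|t| / 2) :=
          apTrunc_norm_mul_cexp_le hs0 hs1 (F k) t
      _ ≤ C * Real.exp (-(b₀ * |t|)) * Real.exp (|t| / 2) :=
          mul_le_mul_of_nonneg_right (h0 k t) (Real.exp_pos _).le
      _ = C * (Real.exp (-(b₀ * |t|)) * Real.exp (|t| / 2)) := by ring
  · exact (hlim t).mul_const _

/-! ## A `k`-uniform bound on the critical line -/

/-- **Quadratic decay on the critical line with an envelope-only constant.** For `g` smooth with
`‖g‖, ‖g'‖, ‖g''‖ ≤ C e^{-b₀|t|}` (`b₀ > 1/2`):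
`‖ĝ(1/2 + it)‖ ≤ 4 C (∫ e^{-b₀|u|} e^{|u|/2} du)/(1 + t²)` — the constant depends on the envelope
`(C, b₀)` only (`zsTrunc_norm_weilMellin_le` and `∫‖g‖e^{|u|/2}, ∫‖g''‖e^{|u|/2} ≤ C ∫ e^{-b₀|u|} e^{|u|/2}`).
[folklore] -/
theorem apDom_norm_weilMellin_half_le {g : ℝ → ℂ} (hg : ContDiff ℝ (⊤ : ℕ∞) g) {C b₀ : ℝ}
    (hb : 1 / 2 < b₀) (h0 : ∀ t, ‖g t‖ ≤ C * Real.exp (-(b₀ * |t|)))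
    (h1 : ∀ t, ‖deriv g t‖ ≤ C * Real.exp (-(b₀ * |t|)))
    (h2 : ∀ t, ‖deriv (deriv g) t‖ ≤ C * Real.exp (-(b₀ * |t|))) (t : ℝ) :
    ‖weilMellin g (1 / 2 + t * I)‖ ≤
      4 * (C * ∫ u : ℝ, Real.exp (-(b₀ * |u|)) * Real.exp (|u| / 2)) / (1 + t ^ 2) := by
  -- two derivatives of `g`
  have hdf : Differentiable ℝ g := (contDiff_infty_iff_deriv.mp hg).1
  have hg' : ContDiff ℝ (⊤ : ℕ∞) (deriv g) := (contDiff_infty_iff_deriv.mp hg).2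
  have hdf' : Differentiable ℝ (deriv g) := (contDiff_infty_iff_deriv.mp hg').1
  have hc'' : Continuous (deriv (deriv g)) := (contDiff_infty_iff_deriv.mp hg').2.continuous
  have hd : ∀ t, HasDerivAt g (deriv g t) t := fun t => (hdf t).hasDerivAt
  have hd' : ∀ t, HasDerivAt (deriv g) (deriv (deriv g) t) t := fun t => (hdf' t).hasDerivAt
  have hgc : Continuous g := hdf.continuous
  have h := zsTrunc_norm_weilMellin_le hd hd' hc'' hb h0 h1 h2 (s := 1 / 2 + t * I)
    (by rw [apTrunc_half_re]; norm_num) (by rw [apTrunc_half_re]; norm_num)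
  rw [apTrunc_half_im] at h
  -- both weighted norms are at most `C J`
  set J : ℝ := ∫ u : ℝ, Real.exp (-(b₀ * |u|)) * Real.exp (|u| / 2) with hJ
  have hCJ : C * J = ∫ u : ℝ, C * (Real.exp (-(b₀ * |u|)) * Real.exp (|u| / 2)) :=
    (integral_const_mul C _).symm
  have hmono : ∀ {φ : ℝ → ℂ}, Continuous φ → (∀ u, ‖φ u‖ ≤ C * Real.exp (-(b₀ * |u|))) →
      ∫ u : ℝ, ‖φ u‖ * Real.exp (|u| / 2) ≤ C * J := by
    intro φ hφ hφb
    rw [hCJ]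
    refine integral_mono (zsTrunc_integrable_norm_mul_exp hφ hb hφb)
      ((zsTrunc_integrable_exp_weight hb).const_mul C) fun u => ?_
    calc ‖φ u‖ * Real.exp (|u| / 2) ≤ C * Real.exp (-(b₀ * |u|)) * Real.exp (|u| / 2) :=
          mul_le_mul_of_nonneg_right (hφb u) (Real.exp_pos _).le
      _ = C * (Real.exp (-(b₀ * |u|)) * Real.exp (|u| / 2)) := by ring
  have hI0 := hmono hgc h0
  have hI2 := hmono hc'' h2
  have hpos : 0 < 1 + t ^ 2 := by positivity
  exact h.trans (div_le_div_of_nonneg_right (by linarith) hpos.le)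

/-! ## The archimedean integral -/

/-- **Dominated convergence of the archimedean integrals.** If the `F k` are smooth with the
common envelope `‖F k‖, ‖(F k)'‖, ‖(F k)''‖ ≤ C e^{-b₀|t|}` (`b₀ > 1/2`) and `F k → G` pointwise,
then `weilArchIntegral (F k) → weilArchIntegral G` (majorant
`K (C_ψ + log(1 + |t|))/(1 + t²)` with `K = 4C ∫ e^{-b₀|u|} e^{|u|/2}`; pointwise convergence on
the critical line by `apDom_tendsto_weilMellin`). [folklore] -/
theorem apDom_tendsto_weilArchIntegral {F : ℕ → ℝ → ℂ} {G : ℝ → ℂ}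
    (hF : ∀ k, ContDiff ℝ (⊤ : ℕ∞) (F k)) {C b₀ : ℝ} (hb : 1 / 2 < b₀)
    (h0 : ∀ k t, ‖F k t‖ ≤ C * Real.exp (-(b₀ * |t|)))
    (h1 : ∀ k t, ‖deriv (F k) t‖ ≤ C * Real.exp (-(b₀ * |t|)))
    (h2 : ∀ k t, ‖deriv (deriv (F k)) t‖ ≤ C * Real.exp (-(b₀ * |t|)))
    (hlim : ∀ t, Tendsto (fun k => F k t) atTop (𝓝 (G t))) :
    Tendsto (fun k => weilArchIntegral (F k)) atTop (𝓝 (weilArchIntegral G)) := by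
  obtain ⟨Cψ, hCψ0, hCψ⟩ := apTrunc_digammaWeight_bound
  have hFc : ∀ k, Continuous (F k) := fun k => (hF k).continuous
  set K : ℝ := 4 * (C * ∫ u : ℝ, Real.exp (-(b₀ * |u|)) * Real.exp (|u| / 2)) with hK
  have hKb : ∀ k (t : ℝ), ‖weilMellin (F k) (1 / 2 + t * I)‖ ≤ K / (1 + t ^ 2) :=
    fun k t => apDom_norm_weilMellin_half_le (hF k) hb (h0 k) (h1 k) (h2 k) t
  unfold weilArchIntegral
  refine tendsto_integral_of_dominated_convergence
    (fun t : ℝ => K * ((Cψ + Real.log (1 + |t|)) / (1 + t ^ 2)))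
    (fun k => ?_) ((apTrunc_integrable_log_div hCψ0).const_mul K)
    (fun k => ae_of_all _ fun t => ?_) (ae_of_all _ fun t => ?_)
  · exact ((apTrunc_continuous_weilMellin_half (hFc k) hb (h0 k)).mul
      apTrunc_continuous_digammaWeight).aestronglyMeasurable
  · have hpos : 0 < 1 + t ^ 2 := by positivity
    have hn := hKb k t
    have hK0 : 0 ≤ K / (1 + t ^ 2) := (norm_nonneg _).trans hn
    rw [norm_mul]
    calc ‖weilMellin (F k) (1 / 2 + t * I)‖ *
          ‖(((Complex.digamma (1 / 4 + t / 2 * I)).re : ℝ) : ℂ)‖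
        ≤ K / (1 + t ^ 2) * (Cψ + Real.log (1 + |t|)) :=
          mul_le_mul hn (hCψ t) (norm_nonneg _) hK0
      _ = K * ((Cψ + Real.log (1 + |t|)) / (1 + t ^ 2)) := by ring
  · exact (apDom_tendsto_weilMellin hFc hb h0 hlim (s := 1 / 2 + t * I)
      (by rw [apTrunc_half_re]; norm_num) (by rw [apTrunc_half_re]; norm_num)).mul_const _

/-! ## The stub -/

/-- **Stub H1 — `weilArchPolar_dominated` (RH-free).**  Dominated convergence for the Mellin,
polar and archimedean sides of the explicit formula on the exponential Weil class: if the `F k`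
are smooth with a COMMON envelope `‖F k‖, ‖(F k)'‖, ‖(F k)''‖ ≤ C e^{-b₀|t|}`, `b₀ > 1/2`, and
`F k → G` pointwise with `G` continuous, then `(F k)^(s) → Ĝ(s)` in the closed strip
`0 ≤ Re s ≤ 1`, `weilPolarTerm (F k) → weilPolarTerm G` and `weilArchTerm (F k) → weilArchTerm G`
(position-space majorant `C e^{(1/2-b₀)|t|}`; on the critical line `‖(F k)^(1/2+it)‖ ≤ K/(1+t²)`
uniformly in `k`, against the weight `C_ψ + log(1+|t|)`; `F k 0 → G 0`). [folklore] -/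
theorem stub_weilArchPolar_dominated :
    ∀ (F : ℕ → ℝ → ℂ) (G : ℝ → ℂ) (C b₀ : ℝ), 1 / 2 < b₀ →
      (∀ k, ContDiff ℝ (⊤ : ℕ∞) (F k)) → Continuous G →
      (∀ k t, ‖F k t‖ ≤ C * Real.exp (-(b₀ * |t|))) →
      (∀ k t, ‖deriv (F k) t‖ ≤ C * Real.exp (-(b₀ * |t|))) →
      (∀ k t, ‖deriv (deriv (F k)) t‖ ≤ C * Real.exp (-(b₀ * |t|))) →
      (∀ t, Tendsto (fun k => F k t) atTop (𝓝 (G t))) →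
      (∀ s : ℂ, 0 ≤ s.re → s.re ≤ 1 →
        Tendsto (fun k => weilMellin (F k) s) atTop (𝓝 (weilMellin G s))) ∧
      Tendsto (fun k => weilPolarTerm (F k)) atTop (𝓝 (weilPolarTerm G)) ∧
      Tendsto (fun k => weilArchTerm (F k)) atTop (𝓝 (weilArchTerm G)) := by
  intro F G C b₀ hb hF _hG h0 h1 h2 hlim
  have hFc : ∀ k, Continuous (F k) := fun k => (hF k).continuous
  have hM : ∀ s : ℂ, 0 ≤ s.re → s.re ≤ 1 →
      Tendsto (fun k => weilMellin (F k) s) atTop (𝓝 (weilMellin G s)) :=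
    fun s hs0 hs1 => apDom_tendsto_weilMellin hFc hb h0 hlim hs0 hs1
  refine ⟨hM, ?_, ?_⟩
  · -- POLAR side: `s = 0` and `s = 1`
    show Tendsto (fun k => weilMellin (F k) 0 + weilMellin (F k) 1) atTop
      (𝓝 (weilMellin G 0 + weilMellin G 1))
    exact (hM 0 (by simp) (by simp)).add (hM 1 (by simp) (by simp))
  · -- ARCHIMEDEAN side
    have hAI := apDom_tendsto_weilArchIntegral hF hb h0 h1 h2 hlim
    show Tendsto (fun k => (1 / (2 * π) : ℂ) * weilArchIntegral (F k) - F k 0 * (Real.log π : ℂ))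
      atTop (𝓝 ((1 / (2 * π) : ℂ) * weilArchIntegral G - G 0 * (Real.log π : ℂ)))
    exact (hAI.const_mul _).sub ((hlim 0).mul_const _)

end Summit.RiemannHypothesis.RiemannHypothesis.Theorems.GroundStatesConvergeToXi

end
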